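import Literature.Probability.Percolation.SharpnessDCTProofs
import Mathlib

/-!
# Crux `PercNearOneGluing.NoHeavyLowerTail` (stmt-CriticalPhenomena-4575), line
`bhk-superadditivity-thinning` — stub `starBadFibre` (fibre identity for the bad event of the star)

Helper file for the crux skeleton (lead prover-line-stmt-CriticalPhenomena-4575-c3-0): proves
exactly the registered stub signature `starBadFibre`; lands with
`--supports stmt-CriticalPhenomena-4575`.

## Content

Weighted complete graph on `Fin n`, a hub `o ∉ A`, a target `b ∈ A`, and a fixed pattern `η` of
open pairs *not containing `o`*.  The pairs at `o` towards `A` are opened independently, the pair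
`s(o, a)` with probability `q a = w s(o, a)`; the opened set `S ⊆ A` has weight
`PA S = (∏_{a ∈ S} q a) (∏_{a ∈ A \ S} (1 - q a))` and produces the configuration
`ω(S, η) = {s(o, a) : a ∈ S} ∪ η`.  Write `x ~ y` for "`x ↔ y` by an open path avoiding `o`"
(`openConnIn {o}ᶜ x y`, an event of `η` alone) and `L(η) = {a ∈ A | a ~ b}`.  Then

`Σ_{S ⊆ A} PA S · 1{ω(S, η) ∈ {o ↔ A} ∩ {o ↮ b}} = ∏_{a ∈ A} (1{a ∈ L} (1 - q a) + 1{a ∉ L}) - ∏_{a ∈ A} (1 - q a)`,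

i.e. given `η`, the bad event `{o ↔ A, o ↮ b}` has conditional probability `Π_L - Π_A`.

## Proof

* Graph fact (`starBF_openConn_iff`): in `ω(S, η)` the open pairs at `o` are exactly the
  `s(o, a)`, `a ∈ S`, so for `x ≠ o`, `o ↔ x` iff some `a ∈ S` has `a ~ x` in `η` (last visit of
  an open path to `o`, `PathIn.last_exit`; the remainder avoids `o` and uses only pairs of `η`).
  Hence `ω(S, η)` is bad iff `S ≠ ∅` and `S ∩ L(η) = ∅` (`starBF_mem_bad_iff`).
* Coin algebra (`starBF_coinExpansion_disjoint`, from `Finset.prod_add`):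
  `Σ_{S ⊆ A, S ∩ L = ∅} PA S = ∏_{a ∈ A ∩ L} (1 - q a)`, and the term `S = ∅` contributes
  `PA ∅ = ∏_{a ∈ A} (1 - q a)`.
-/

open scoped Classical

namespace Summit.CriticalPhenomena.PercolationContinuityZ3.Theorems

open Literature.Probability.Percolation

section StarBadFibreAux

variable {n : ℕ}

/-- **Independent-coin subset expansion** (generic index type).  For coins on `S` with weights
`q a`, summing the pattern weights `(∏_{a ∈ Z} q a) (∏_{a ∈ S \ Z} (1 - q a))` over the sets
`Z ⊆ S` disjoint from `T` gives `∏_{a ∈ S ∩ T} (1 - q a)`.  A polynomial identity, from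
`Finset.prod_add` with `f = 1{· ∉ T} q`, `g = 1 - q` (same argument as the landed
`coinExpansion_disjoint`, which is stated for `Finset ℕ`). [folklore] -/
theorem starBF_coinExpansion_disjoint {α : Type*} [DecidableEq α] (S T : Finset α) (q : α → ℝ) :
    ∑ Z ∈ S.powerset, (if Disjoint Z T then (∏ a ∈ Z, q a) * (∏ a ∈ S \ Z, (1 - q a)) else 0)
      = ∏ a ∈ S.filter (fun a => a ∈ T), (1 - q a) := by
  have key : ∏ a ∈ S, ((if a ∉ T then q a else 0) + (1 - q a))
      = ∏ a ∈ S.filter (fun a => a ∈ T), (1 - q a) := by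
    rw [Finset.prod_filter]
    refine Finset.prod_congr rfl (fun a _ => ?_)
    by_cases h : a ∈ T
    · rw [if_neg (fun h' => h' h), if_pos h, zero_add]
    · rw [if_pos h, if_neg h, add_sub_cancel]
  rw [← key, Finset.prod_add]
  refine Finset.sum_congr rfl (fun Z _ => ?_)
  rw [Finset.prod_ite_zero]
  by_cases hZT : Disjoint Z T
  · rw [if_pos hZT, if_pos (fun a ha => Finset.disjoint_left.1 hZT ha)]
  · rw [if_neg hZT, if_neg (fun h => hZT (Finset.disjoint_left.2 (fun a ha => h a ha))), zero_mul]

/-- **The star sees `{o}ᶜ` only through its tips.**  Let `ω = {s(o, a) : a ∈ S} ∪ η` with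
`o ∉ S` and no pair of `η` containing `o`.  For `x ≠ o`, `o ↔ x` in `ω` iff some `a ∈ S` is
joined to `x` in `η` by an open path avoiding `o`: the last visit to `o` of an open path `o → x`
leaves through a pair `s(o, a)`, `a ∈ S`, and the remainder avoids `o`, hence only uses pairs of
`η`; conversely the pair `s(o, a)` followed by such a path joins `o` to `x`. [folklore] -/
theorem starBF_openConn_iff {o x : Fin n} {S : Finset (Fin n)} (hoS : o ∉ S)
    {η : Finset (Sym2 (Fin n))} (hη : ∀ e ∈ η, o ∉ e) (hx : x ≠ o) :
    ((↑(S.image (fun a => s(o, a))) ∪ ↑η : Set (Sym2 (Fin n))) ∈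
        (openConn o x : Set (BondConfig (Fin n)))) ↔
      ∃ a ∈ S, (↑η : Set (Sym2 (Fin n))) ∈ openConnIn (({o} : Set (Fin n))ᶜ) a x := by
  set ω : BondConfig (Fin n) := (↑(S.image (fun a => s(o, a))) ∪ ↑η : Set (Sym2 (Fin n))) with hω
  constructor
  · intro h
    have hp : PathIn (openGraph ω) Set.univ o x := DCT16.pathIn_univ_of_reachable h
    obtain ⟨a, c, ha, -, hc, hac, hcx⟩ :=
      hp.last_exit (C := ({o} : Set (Fin n))) (Set.mem_singleton o) (fun h' => hx h')
    have hao : a = o := ha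
    rw [hao, openGraph_adj] at hac
    have hstar : s(o, c) ∈ S.image (fun a => s(o, a)) := by
      rcases hac.1 with h1 | h1
      · exact h1
      · exact absurd (Sym2.mem_mk_left o c) (hη _ h1)
    obtain ⟨a', ha'S, he⟩ := Finset.mem_image.1 hstar
    have hc' : a' = c := by
      rcases Sym2.eq_iff.1 he with ⟨_, h2⟩ | ⟨h2, h3⟩
      · exact h2
      · exact h3.trans h2
    refine ⟨a', ha'S, ?_⟩
    rw [hc']
    refine DCT16.mem_openConnIn_of_pathIn ?_
    have hcx' : PathIn (openGraph ω) (({o} : Set (Fin n))ᶜ) c x := by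
      rw [Set.compl_eq_univ_sdiff]; exact hcx
    refine DCT16.pathIn_congrGraph (fun u v hu hv huv => ?_) hcx'
    rw [openGraph_adj] at huv ⊢
    refine ⟨?_, huv.2⟩
    rcases huv.1 with h1 | h1
    · obtain ⟨a'', -, he''⟩ := Finset.mem_image.1 h1
      have ho : o ∈ s(u, v) := by rw [← he'']; exact Sym2.mem_mk_left o a''
      rcases Sym2.mem_iff.1 ho with h2 | h2
      · exact absurd h2.symm hu
      · exact absurd h2.symm hv
    · exact h1
  · rintro ⟨a, haS, h⟩
    have hp : PathIn (openGraph (↑η : Set (Sym2 (Fin n)))) (({o} : Set (Fin n))ᶜ) a x :=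
      DCT16.pathIn_of_mem_openConnIn h
    have hp' : PathIn (openGraph ω) (({o} : Set (Fin n))ᶜ) a x :=
      hp.mono_graph (SimpleGraph.fromEdgeSet_mono Set.subset_union_right)
    have hadj : (openGraph ω).Adj o a := by
      rw [openGraph_adj]
      refine ⟨Set.mem_union_left _ (Finset.mem_coe.2 (Finset.mem_image_of_mem _ haS)), ?_⟩
      rintro rfl
      exact hoS haS
    exact hadj.reachable.trans (DCT16.reachable_of_pathIn hp')

/-- **The bad event on a fibre.**  With `ω = {s(o, a) : a ∈ S} ∪ η`, `S ⊆ A ∌ o`, `b ∈ A` and no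
pair of `η` containing `o`: `ω ∈ {o ↔ A} ∩ {o ↮ b}` iff `S ≠ ∅` (the pair `s(o, a)` itself joins
`o` to `a ∈ A`) and no `a ∈ S` is joined to `b` in `η` avoiding `o`. [folklore] -/
theorem starBF_mem_bad_iff {A S : Finset (Fin n)} {o b : Fin n} (hoA : o ∉ A) (hbA : b ∈ A)
    (hSA : S ⊆ A) {η : Finset (Sym2 (Fin n))} (hη : ∀ e ∈ η, o ∉ e) :
    ((↑(S.image (fun a => s(o, a))) ∪ ↑η : Set (Sym2 (Fin n))) ∈
        ((⋃ a ∈ A, openConn o a) ∩ (openConn o b)ᶜ : Set (BondConfig (Fin n)))) ↔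
      (S.Nonempty ∧ ∀ a ∈ S, (↑η : Set (Sym2 (Fin n))) ∉ openConnIn (({o} : Set (Fin n))ᶜ) a b) := by
  have hoS : o ∉ S := fun h => hoA (hSA h)
  have hbo : b ≠ o := fun h => hoA (h ▸ hbA)
  rw [Set.mem_inter_iff, Set.mem_compl_iff, Set.mem_iUnion₂,
    starBF_openConn_iff hoS hη hbo]
  constructor
  · rintro ⟨⟨a, haA, ha⟩, hb⟩
    have hao : a ≠ o := fun h => hoA (h ▸ haA)
    obtain ⟨a', ha'S, -⟩ := (starBF_openConn_iff hoS hη hao).1 ha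
    exact ⟨⟨a', ha'S⟩, fun a'' ha'' h'' => hb ⟨a'', ha'', h''⟩⟩
  · rintro ⟨⟨a, haS⟩, hb⟩
    refine ⟨⟨a, hSA haS, ?_⟩, fun ⟨a'', ha'', h''⟩ => hb a'' ha'' h''⟩
    have hao : a ≠ o := fun h => hoS (h ▸ haS)
    refine (starBF_openConn_iff hoS hη hao).2 ⟨a, haS, ?_⟩
    have hac : a ∈ (({o} : Set (Fin n))ᶜ) := by
      simpa only [Set.mem_compl_iff, Set.mem_singleton_iff] using hao
    exact ⟨hac, hac, SimpleGraph.Reachable.refl _⟩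

end StarBadFibreAux

/-- **Fibre identity for the bad event of the star** (registered stub `starBadFibre` of crux
stmt-CriticalPhenomena-4575, line bhk-superadditivity-thinning).  Hub `o ∉ A`, target `b ∈ A`,
pattern `η` of open pairs off `o`, coins `q a = w s(o, a)` on the pairs from `o` to `A` with
pattern law `PA S = (∏_{a ∈ S} q a) (∏_{a ∈ A \ S} (1 - q a))`, configuration
`ω(S, η) = {s(o, a) : a ∈ S} ∪ η`, and `L(η) = {a ∈ A | a ↔ b avoiding o in η}`:
`Σ_{S ⊆ A} PA S · 1{ω(S, η) ∈ {o ↔ A} ∩ {o ↮ b}} = ∏_{a ∈ A} (1{a ∈ L}(1 - q a) + 1{a ∉ L}) - ∏_{a ∈ A} (1 - q a)`.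
Proof: `ω(S, η)` is bad iff `S ≠ ∅` and `S ∩ L = ∅` (`starBF_mem_bad_iff`), and the coin sum
over `S` disjoint from `L` is `∏_{A ∩ L} (1 - q)` (`starBF_coinExpansion_disjoint`), from which
the `S = ∅` term `∏_A (1 - q)` is removed. -/
theorem starBadFibre : ∀ (n : ℕ) (w : Sym2 (Fin n) → unitInterval) (A : Finset (Fin n)) (o b : Fin n) (η : Finset (Sym2 (Fin n))), o ∉ A → b ∈ A → (∀ e ∈ η, o ∉ e) → ∑ S ∈ A.powerset, ((∏ a ∈ S, ((w s(o, a) : unitInterval) : ℝ)) * ∏ a ∈ A \ S, (1 - ((w s(o, a) : unitInterval) : ℝ))) * (if ((↑(S.image (fun a => s(o, a))) ∪ ↑η : Set (Sym2 (Fin n))) ∈ ((⋃ a ∈ A, Literature.Probability.Percolation.openConn o a) ∩ (Literature.Probability.Percolation.openConn o b)ᶜ : Set (Literature.Probability.Percolation.BondConfig (Fin n)))) then (1 : ℝ) else 0) = (∏ a ∈ A, (if a ∈ A.filter (fun a' => (↑η : Set (Sym2 (Fin n))) ∈ Literature.Probability.Percolation.openConnIn (({o} : Set (Fin n))ᶜ)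 a' b) then (1 : ℝ) - ((w s(o, a) : unitInterval) : ℝ) else 1)) - ∏ a ∈ A, (1 - ((w s(o, a) : unitInterval) : ℝ)) := by
  intro n w A o b η hoA hbA hη
  set L : Finset (Fin n) :=
    A.filter (fun a' => (↑η : Set (Sym2 (Fin n))) ∈ openConnIn (({o} : Set (Fin n))ᶜ) a' b) with hL
  set q : Fin n → ℝ := fun a => ((w s(o, a) : unitInterval) : ℝ) with hq
  -- Step 1: the bad indicator on the fibre is `1{S ∩ L = ∅} - 1{S = ∅}`.
  have hsum : ∑ S ∈ A.powerset, ((∏ a ∈ S, q a) * ∏ a ∈ A \ S, (1 - q a)) *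
        (if ((↑(S.image (fun a => s(o, a))) ∪ ↑η : Set (Sym2 (Fin n))) ∈
            ((⋃ a ∈ A, openConn o a) ∩ (openConn o b)ᶜ : Set (BondConfig (Fin n))))
          then (1 : ℝ) else 0)
      = ∑ S ∈ A.powerset, ((if Disjoint S L then (∏ a ∈ S, q a) * ∏ a ∈ A \ S, (1 - q a) else 0)
          - (if S = ∅ then (∏ a ∈ S, q a) * ∏ a ∈ A \ S, (1 - q a) else 0)) := by
    refine Finset.sum_congr rfl (fun S hS => ?_)
    have hSA : S ⊆ A := Finset.mem_powerset.1 hS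
    have hiff := starBF_mem_bad_iff hoA hbA hSA hη
    have hdisj : Disjoint S L ↔
        ∀ a ∈ S, (↑η : Set (Sym2 (Fin n))) ∉ openConnIn (({o} : Set (Fin n))ᶜ) a b := by
      rw [Finset.disjoint_left]
      refine forall₂_congr (fun a haS => ?_)
      rw [hL, Finset.mem_filter, not_and]
      exact ⟨fun h => h (hSA haS), fun h _ => h⟩
    by_cases hbad : ((↑(S.image (fun a => s(o, a))) ∪ ↑η : Set (Sym2 (Fin n))) ∈
        ((⋃ a ∈ A, openConn o a) ∩ (openConn o b)ᶜ : Set (BondConfig (Fin n))))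
    · rw [if_pos hbad, mul_one]
      obtain ⟨hne, hd⟩ := hiff.1 hbad
      rw [if_pos (hdisj.2 hd), if_neg (Finset.nonempty_iff_ne_empty.1 hne), sub_zero]
    · rw [if_neg hbad, mul_zero]
      by_cases hSe : S = ∅
      · rw [if_pos hSe, if_pos (hSe ▸ Finset.disjoint_empty_left L), sub_self]
      · have hnd : ¬ Disjoint S L := fun hd =>
          hbad (hiff.2 ⟨Finset.nonempty_iff_ne_empty.2 hSe, hdisj.1 hd⟩)
        rw [if_neg hnd, if_neg hSe, sub_self]
  rw [hsum, Finset.sum_sub_distrib, starBF_coinExpansion_disjoint A L q, Finset.sum_ite_eq',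
    if_pos (Finset.empty_mem_powerset A), Finset.prod_empty, one_mul, Finset.sdiff_empty,
    Finset.prod_filter]

end Summit.CriticalPhenomena.PercolationContinuityZ3.Theorems
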